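import Mathlib

/-!
# The near-threshold inner solution of the third-order pattern equation

Kernel of solo-blind paper §24.17(5).  In the columnar (n = ∞) limit the reduced steady pattern
problem near threshold (`ΔK₀ = sup σ - K₀ → 0`, inner variable `s = (c - c*)/ℓ`, `ℓ² = 2ΔK₀/|σ''(c*)|`)
is, at leading order, the THIRD-order free-boundary problem

  `β₃ q‴ = ΔK₀ (1 - s²)` on the support of `q`,  `q ≥ 0`,  `q = q' = 0` at both contact points,

with only one further condition available (`q'' = 0` at one end).  For `β₃ > 0` (after scaling,
`Q‴ = 1 - s²`) the admissible solution is EXPLICIT: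

  `Q(s) = (u - s)³ (s + v)² / 60` on `[-v, u]`,  `u = √(8/3)`, `v = √6` (so `3u = 2v`, `v² = 6`):

`Q‴ = 1 - s²`, `Q ≥ 0` on `[-v, u]`, a C² contact at the downstream end `u`
(`Q(u) = Q'(u) = Q''(u) = 0`) and a C¹ contact at `-v` (`Q(-v) = Q'(-v) = 0`, `Q''(-v) = (u+v)³/30 > 0`).
Only the algebraic relations `3u = 2v`, `v² = 6` are used, so the statements are exact over `ℝ`.
(The case `β₃ < 0` is the mirror image `s ↦ -s`.)
-/

namespace Summit.AnomalousDissipation.AnomalousDissipation.Theorems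

/-- The inner profile `Q(s) = (u - s)³ (s + v)² / 60`. -/
noncomputable def cubicInnerQ (u v s : ℝ) : ℝ := (u - s) ^ 3 * (s + v) ^ 2 / 60

/-- Its first derivative. -/
noncomputable def cubicInnerQ1 (u v s : ℝ) : ℝ :=
  (-3 * (u - s) ^ 2 * (s + v) ^ 2 + 2 * (u - s) ^ 3 * (s + v)) / 60

/-- Its second derivative. -/
noncomputable def cubicInnerQ2 (u v s : ℝ) : ℝ :=
  (6 * (u - s) * (s + v) ^ 2 - 12 * (u - s) ^ 2 * (s + v) + 2 * (u - s) ^ 3) / 60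

/-- Its third derivative. -/
noncomputable def cubicInnerQ3 (u v s : ℝ) : ℝ :=
  (-6 * (s + v) ^ 2 + 36 * (u - s) * (s + v) - 18 * (u - s) ^ 2) / 60

/-- `Q' = Q₁`. -/
theorem hasDerivAt_cubicInnerQ (u v s : ℝ) :
    HasDerivAt (cubicInnerQ u v) (cubicInnerQ1 u v s) s := by
  have h1 : HasDerivAt (fun x : ℝ => u - x) (-1) s := by
    simpa using (hasDerivAt_id s).const_sub u
  have h2 : HasDerivAt (fun x : ℝ => x + v) 1 s := by
    simpa using (hasDerivAt_id s).add_const v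
  have h := ((h1.pow 3).mul (h2.pow 2)).div_const 60
  unfold cubicInnerQ
  refine h.congr_deriv ?_
  simp only [cubicInnerQ1, Pi.pow_apply, Nat.cast_ofNat,
    show (3:ℕ) - 1 = 2 from rfl, show (2:ℕ) - 1 = 1 from rfl, pow_one]
  ring

/-- `Q₁' = Q₂`. -/
theorem hasDerivAt_cubicInnerQ1 (u v s : ℝ) :
    HasDerivAt (cubicInnerQ1 u v) (cubicInnerQ2 u v s) s := by
  have h1 : HasDerivAt (fun x : ℝ => u - x) (-1) s := by
    simpa using (hasDerivAt_id s).const_sub u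
  have h2 : HasDerivAt (fun x : ℝ => x + v) 1 s := by
    simpa using (hasDerivAt_id s).add_const v
  have h := ((((h1.pow 2).const_mul (-3)).mul (h2.pow 2)).add
    (((h1.pow 3).const_mul 2).mul h2)).div_const 60
  unfold cubicInnerQ1
  refine h.congr_deriv ?_
  simp only [cubicInnerQ2, Pi.pow_apply, Nat.cast_ofNat,
    show (3:ℕ) - 1 = 2 from rfl, show (2:ℕ) - 1 = 1 from rfl, pow_one]
  ring

/-- `Q₂' = Q₃`. -/
theorem hasDerivAt_cubicInnerQ2 (u v s : ℝ) :
    HasDerivAt (cubicInnerQ2 u v) (cubicInnerQ3 u v s) s := by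
  have h1 : HasDerivAt (fun x : ℝ => u - x) (-1) s := by
    simpa using (hasDerivAt_id s).const_sub u
  have h2 : HasDerivAt (fun x : ℝ => x + v) 1 s := by
    simpa using (hasDerivAt_id s).add_const v
  have h := (((((h1.const_mul 6).mul (h2.pow 2)).sub
    (((h1.pow 2).const_mul 12).mul h2)).add ((h1.pow 3).const_mul 2))).div_const 60
  unfold cubicInnerQ2
  refine h.congr_deriv ?_
  simp only [cubicInnerQ3, Pi.pow_apply, Nat.cast_ofNat,
    show (3:ℕ) - 1 = 2 from rfl, show (2:ℕ) - 1 = 1 from rfl, pow_one]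
  ring

/-- The inner equation: with `3u = 2v` and `v² = 6` (i.e. `u = √(8/3)`, `v = √6`),
`Q‴(s) = 1 - s²` identically. -/
theorem cubicInnerQ3_eq (u v : ℝ) (huv : 3 * u = 2 * v) (hv : v ^ 2 = 6) (s : ℝ) :
    cubicInnerQ3 u v s = 1 - s ^ 2 := by
  have hu : u = 2 * v / 3 := by linarith
  unfold cubicInnerQ3
  rw [hu]
  linear_combination (1 / 6 : ℝ) * hv

/-- Contact conditions: C² contact at the downstream end `u` … -/
theorem cubicInnerQ_contact_right (u v : ℝ) :
    cubicInnerQ u v u = 0 ∧ cubicInnerQ1 u v u = 0 ∧ cubicInnerQ2 u v u = 0 := by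
  unfold cubicInnerQ cubicInnerQ1 cubicInnerQ2
  exact ⟨by ring, by ring, by ring⟩

/-- … and C¹ contact at the upstream end `-v`, where `Q''` jumps to `(u+v)³/30`. -/
theorem cubicInnerQ_contact_left (u v : ℝ) :
    cubicInnerQ u v (-v) = 0 ∧ cubicInnerQ1 u v (-v) = 0 ∧
      cubicInnerQ2 u v (-v) = (u + v) ^ 3 / 30 := by
  unfold cubicInnerQ cubicInnerQ1 cubicInnerQ2
  exact ⟨by ring, by ring, by ring⟩

/-- Admissibility: `Q ≥ 0` on the support `[-v, u]` (indeed for all `s ≤ u`). -/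
theorem cubicInnerQ_nonneg (u v s : ℝ) (hs : s ≤ u) : 0 ≤ cubicInnerQ u v s := by
  unfold cubicInnerQ
  have h1 : 0 ≤ (u - s) ^ 3 := pow_nonneg (sub_nonneg.mpr hs) 3
  have h2 : 0 ≤ (s + v) ^ 2 := sq_nonneg _
  exact div_nonneg (mul_nonneg h1 h2) (by norm_num)

/-- Summary: on `[-v, u]` the profile solves the third-order inner problem `Q‴ = 1 - s²` with the
free-boundary conditions `Q(-v) = Q'(-v) = 0`, `Q(u) = Q'(u) = Q''(u) = 0` and `Q ≥ 0`. -/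
theorem cubicInner_solution (u v : ℝ) (huv : 3 * u = 2 * v) (hv : v ^ 2 = 6) :
    (∀ s, HasDerivAt (cubicInnerQ u v) (cubicInnerQ1 u v s) s) ∧
    (∀ s, HasDerivAt (cubicInnerQ1 u v) (cubicInnerQ2 u v s) s) ∧
    (∀ s, HasDerivAt (cubicInnerQ2 u v) (1 - s ^ 2) s) ∧
    (∀ s ∈ Set.Icc (-v) u, 0 ≤ cubicInnerQ u v s) ∧
    cubicInnerQ u v (-v) = 0 ∧ cubicInnerQ1 u v (-v) = 0 ∧
    cubicInnerQ u v u = 0 ∧ cubicInnerQ1 u v u = 0 ∧ cubicInnerQ2 u v u = 0 :=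
  ⟨hasDerivAt_cubicInnerQ u v, hasDerivAt_cubicInnerQ1 u v,
    fun s => (hasDerivAt_cubicInnerQ2 u v s).congr_deriv (cubicInnerQ3_eq u v huv hv s),
    fun s hs => cubicInnerQ_nonneg u v s hs.2,
    (cubicInnerQ_contact_left u v).1, (cubicInnerQ_contact_left u v).2.1,
    (cubicInnerQ_contact_right u v).1, (cubicInnerQ_contact_right u v).2.1,
    (cubicInnerQ_contact_right u v).2.2⟩

end Summit.AnomalousDissipation.AnomalousDissipation.Theorems
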